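import Summits.HubbardSuperconductivity.HubbardSuperconductivity.Theorems.WidthHaldaneDefs
import Summits.HubbardSuperconductivity.HubbardSuperconductivity.Theorems.WidthHaldaneEtaLowestWeight

/-!
# Sketch — crux idea `eta-amplifier-complement` (crux stmt-HubbardSuperconductivity-16311, round 2, ideator 5)

First lemmas of the η-AMPLIFIER line, typed over the landed vocabulary of `WidthHaldaneDefs`
(`tubeH0`, `tubeDWavePair`, `tubeFilling`, `szSector`, `etaLower`, `etaRaise`). Nothing is proved here;
the statements must only elaborate (`lean check` rc 0, no sorry: everything is a `def … : Prop`).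

Objects. `η_ε = etaLower ε` (a bipartite sign `ε` of the even tube), `Δ = Σ_x P_x` the TOTAL tube
`d_{x²-y²}` pair field (sum of the crux's `tubeDWavePair` over all sites = Σ_a Φ_a, so that
`‖Δψ‖² = Σ_r G_ψ(r)`), and the `d`-DENSITY-WAVE CURRENT `D = [η, Δᴴ]` — the middle component of the
η-triplet `(Δᴴ, D, Δ)` (landed `WidthHaldaneColumnPairTriplet`: `[η,[η,Φ_aᴴ]] = 2Φ_a`,
`[ηᴴ, Φ_aᴴ] = 0`).

(A) `EtaAmplifierIdentity` — for an η-lowest-weight vector (`ηψ = 0`, landed consequence of the STRICT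
    clause `0 < ẽ″` of `UniformThermo`): `4‖Δψ‖² = ‖ηDψ‖²` (because `ηDψ = [η,D]ψ = 2Δψ`).
(B) `EtaRaisedShare` — the COMPLEMENT form that carries the macroscopic factor: with the η-spin
    `J₀ = (|Λ| - N)/2` of the sector and `χ := Dψ - (J₀+1)⁻¹ ηᴴ Δ ψ` (the η-lowest-weight part of `Dψ`;
    `ηχ = 0`): `2‖Δψ‖² = (J₀ + 1)(‖Dψ‖² - ‖χ‖²)` — i.e. `d`-wave pair order is `(δLM/4 + ½)` times
    the η-RAISED share of the (π,π) DDW-current fluctuation. (Casimir: `ηᴴη = 2(J₀+1)` on the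
    `J = J₀+1` component of `Dψ`, `0` on the `J = J₀` component; `Dψ` has no other components.)
(C) `EtaAmplifierEngine` — the inequality the line is built on (ORDER from a neutral incoherent-scale
    FLOOR and two CEILINGS): if `ηψ = 0`, `ψ` a sector ground state of `tubeH0` with energy `E₀`,
    `Dψ ⊥` the ground eigenspace, `‖Dψ‖² ≥ κ₁|Λ|` (DDW-current fluctuation floor),
    `Re⟨Dψ,(H₀ - E₀)Dψ⟩ ≤ κ₂|Λ|` (f-sum ceiling, local double commutators) and
    `Re⟨Dψ, R Dψ⟩ ≤ κ₃|Λ|` for a "resolvent" `R` with `Re⟨v,Rv⟩·Re⟨v,(H₀-E₀)v⟩ ≥ (Re⟨v,v⟩)²` on the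
    lowest-weight part `v = χ` (static DDW susceptibility ceiling = an ENERGY-curvature floor of the tube in
    a weak staggered flux), then `2‖Δψ‖² ≥ (J₀+1)(κ₁ - √(κ₂κ₃))|Λ|`.
-/

noncomputable section

namespace Summit.HubbardSuperconductivity.HubbardSuperconductivity.Cruxes.WidthHaldaneBridge.EtaAmplifier

open scoped BigOperators Classical Matrix ComplexConjugate
open Matrix Literature.MathematicalPhysics.QuantumLattice
open Summit.HubbardSuperconductivity.HubbardSuperconductivity.Theorems.WidthHaldane

variable (L M : ℕ) (Λ : Type) [LinearOrder Λ] [Fintype Λ] (e : Λ ≃ ZMod L × ZMod M)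

/-- The TOTAL tube `d_{x²-y²}` pair field `Δ = Σ_x P_x` (= `Σ_a Φ_a`, the `k = 0` column mode). -/
def tubePairFieldTotal : Matrix (Finset (Orb Λ)) (Finset (Orb Λ)) ℂ :=
  ∑ x : Λ, tubeDWavePair L M Λ e x

/-- The `d`-density-wave current `D = [η_ε, Δᴴ] = η Δᴴ - Δᴴ η` (η-partner of the pair field). -/
def ddwCurrent (ε : Λ → ℤˣ) : Matrix (Finset (Orb Λ)) (Finset (Orb Λ)) ℂ :=
  etaLower ε * (tubePairFieldTotal L M Λ e)ᴴ - (tubePairFieldTotal L M Λ e)ᴴ * etaLower ε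

/-- (A) `4‖Δψ‖² = ‖η D ψ‖²` on η-lowest-weight vectors. -/
def EtaAmplifierIdentity : Prop :=
  ∀ (ε : Λ → ℤˣ), (∀ x y, (tubeGraph e).Adj x y → ε x = -ε y) →
    ∀ ψ : Fock (Orb Λ), etaLower ε *ᵥ ψ = 0 →
      (4 : ℂ) * (star (tubePairFieldTotal L M Λ e *ᵥ ψ) ⬝ᵥ (tubePairFieldTotal L M Λ e *ᵥ ψ)) =
        star ((etaLower ε * ddwCurrent L M Λ e ε) *ᵥ ψ) ⬝ᵥ ((etaLower ε * ddwCurrent L M Λ e ε) *ᵥ ψ)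

/-- (B) THE η-RAISED SHARE (first lemma of the line): `2‖Δψ‖² = (J₀+1)(‖Dψ‖² - ‖χ‖²)`,
`χ = Dψ - (J₀+1)⁻¹ ηᴴ Δψ` the lowest-weight part of `Dψ` (`ηχ = 0`), `J₀ = (|Λ| - N)/2`. -/
def EtaRaisedShare : Prop :=
  ∀ (ε : Λ → ℤˣ), (∀ x y, (tubeGraph e).Adj x y → ε x = -ε y) →
    ∀ (N : ℕ) (ψ : Fock (Orb Λ)), ψ ∈ szSector N (0 : ℝ) → N ≤ Fintype.card Λ →
      Even (Fintype.card Λ - N) → etaLower ε *ᵥ ψ = 0 →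
      let J : ℂ := (((Fintype.card Λ - N) / 2 : ℕ) : ℂ) + 1
      let Δψ := tubePairFieldTotal L M Λ e *ᵥ ψ
      let Dψ := ddwCurrent L M Λ e ε *ᵥ ψ
      let χ := Dψ - J⁻¹ • (etaRaise ε *ᵥ Δψ)
      etaLower ε *ᵥ χ = 0 ∧
        (2 : ℂ) * (star Δψ ⬝ᵥ Δψ) = J * (star Dψ ⬝ᵥ Dψ - star χ ⬝ᵥ χ)

/-- (C) THE ENGINE INEQUALITY (order from a neutral floor and two ceilings), over an abstract
PSD "resolvent" witness `R` for the static susceptibility (crux-plan types `R` as the reduced resolvent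
of `tubeH0` on the sector, or replaces the `R`-clause by the energy-curvature floor
`E(tubeH0 + h·X) ≥ E₀ - κ₃|Λ|h²/2` for the Hermitian parts `X` of `D`). -/
def EtaAmplifierEngine : Prop :=
  ∀ (ε : Λ → ℤˣ), (∀ x y, (tubeGraph e).Adj x y → ε x = -ε y) →
    ∀ (U : ℝ) (N : ℕ) (ψ : Fock (Orb Λ)) (κ₁ κ₂ κ₃ : ℝ),
      IsGroundStateInSector (tubeH0 L M Λ e U) N 0 ψ → star ψ ⬝ᵥ ψ = 1 → etaLower ε *ᵥ ψ = 0 →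
      N ≤ Fintype.card Λ → Even (Fintype.card Λ - N) → 0 ≤ κ₂ → 0 ≤ κ₃ →
      let E₀ : ℝ := (tubeH0 L M Λ e U).minEnergyOn (szSector N 0)
      let H' : Matrix (Finset (Orb Λ)) (Finset (Orb Λ)) ℂ := tubeH0 L M Λ e U - ((E₀ : ℝ) : ℂ) • 1
      let J : ℝ := (((Fintype.card Λ - N) / 2 : ℕ) : ℝ) + 1
      let Δψ := tubePairFieldTotal L M Λ e *ᵥ ψ
      let Dψ := ddwCurrent L M Λ e ε *ᵥ ψ
      let χ := Dψ - ((J : ℝ) : ℂ)⁻¹ • (etaRaise ε *ᵥ Δψ)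
      -- floor on the DDW-current fluctuation, f-sum ceiling, susceptibility ceiling via a witness `R`
      κ₁ * Fintype.card Λ ≤ (star Dψ ⬝ᵥ Dψ).re →
      (star Dψ ⬝ᵥ (H' *ᵥ Dψ)).re ≤ κ₂ * Fintype.card Λ →
      (∀ R : Matrix (Finset (Orb Λ)) (Finset (Orb Λ)) ℂ,
          ((star χ ⬝ᵥ χ).re) ^ 2 ≤ (star χ ⬝ᵥ (H' *ᵥ χ)).re * (star χ ⬝ᵥ (R *ᵥ χ)).re →
          (star Dψ ⬝ᵥ (R *ᵥ Dψ)).re ≤ κ₃ * Fintype.card Λ →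
          (star χ ⬝ᵥ (R *ᵥ χ)).re ≤ (star Dψ ⬝ᵥ (R *ᵥ Dψ)).re) →
      (star χ ⬝ᵥ (H' *ᵥ χ)).re ≤ (star Dψ ⬝ᵥ (H' *ᵥ Dψ)).re →
      J * (κ₁ - Real.sqrt (κ₂ * κ₃)) * Fintype.card Λ ≤ 2 * (star Δψ ⬝ᵥ Δψ).re

end Summit.HubbardSuperconductivity.HubbardSuperconductivity.Cruxes.WidthHaldaneBridge.EtaAmplifier

end
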